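import Summits.ResolutionOfSingularities.ResolutionOfSingularities.Theorems.FrobeniusLadderFInjectiveMacaulayficationWeightedConeFiModel
import Summits.ResolutionOfSingularities.ResolutionOfSingularities.Theorems.FrobeniusLadderFInjectiveMacaulayficationF4Isolated
import Summits.ResolutionOfSingularities.ResolutionOfSingularities.Theorems.FrobeniusLadderFInjectiveMacaulayficationVeroneseSplitting
import Summits.ResolutionOfSingularities.ResolutionOfSingularities.Theorems.FrobeniusLadderFInjectiveMacaulayficationF4ChartX
import Summits.ResolutionOfSingularities.ResolutionOfSingularities.Theorems.FrobeniusLadderFInjectiveMacaulayficationF4ChartY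
import Summits.ResolutionOfSingularities.ResolutionOfSingularities.Theorems.FrobeniusLadderFInjectiveMacaulayficationF4ChartZ
import Summits.ResolutionOfSingularities.ResolutionOfSingularities.Theorems.FrobeniusLadderFInjectiveMacaulayficationF4ChartT
import Summits.ResolutionOfSingularities.ResolutionOfSingularities.Theorems.FrobeniusLadderFInjectiveMacaulayficationPrimeTransfer
import Summits.ResolutionOfSingularities.ResolutionOfSingularities.Theorems.FrobeniusLadderFInjectiveMacaulayficationThreefoldNotDvd
import HarnessLib

/-!
# The calibration `f₄`: a weighted blow-up F-injectivizes the point NO tower of point blow-ups fixes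
# (registered stub #24 of skeleton 10f06f91, line `Sketch`, §15; crux stmt-ResolutionOfSingularities-15315)

Support file for crux stmt-ResolutionOfSingularities-15315 (`FrobeniusLadder.FInjectiveMacaulayfication`), chain w45a, lead seat
res-L1-w45a-lead-1. THE REGISTERED STUB `stub_f4WeightedFiModel` (#24): over every field `k` of characteristic `5`, the threefold
`Spec k[X₀,…,X₃]/(f₄)`, `f₄ = X₂² + X₀³ + X₁⁶ + X₃³X₀²` (weighted-homogeneous of degree `18` for the weights `(6,3,9,2)`), admits a
proper birational model all of whose stalks are domains satisfying the per-stalk clause of the crux — the weighted blow-up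
`affineBlowup I₁₈` of its ONLY bad point (`F4Isolated`, p174155), a point at which EVERY tower of closed-point blow-ups fails forever
(`PointTowerNeverFInjective`, p173746). PROOF = the engine #23 `WeightedConeFiModel.stub_weightedConeFiModel` at `w = (6,3,9,2)`,
`N = D = 18`, `c = (3,6,2,9)`, fed with `F4Isolated` (prime, clause off the origin), `VeroneseSplitting` (p173737: `I_{18K} ⊆ I₁₈^K`),
`f4_X_ne_zero` and the four chart stubs #15–#18 `F4ChartX/Y/Z/T` (p459672 p458929 p458999 p459447; weighted homogeneity transported
from `ZMod 6/3/9/2` to `ZMod (w v)` by `funext`/`decide`).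
-/

set_option linter.dupNamespace false

open AlgebraicGeometry CategoryTheory Literature.AlgebraicGeometry.Resolution MvPolynomial

namespace Summit.ResolutionOfSingularities.ResolutionOfSingularities.Theorems.FInjectiveMacaulayfication.F4WeightedFiModel

/-- No chart variable lies in `(f₄)`: evaluation at a point with `X_v = 0` and `f₄ = 1`. [folklore] -/
theorem f4_X_ne_zero (k : Type) [Field k] (f : MvPolynomial (Fin 4) k)
    (hf : f = MvPolynomial.X 2 ^ 2 + MvPolynomial.X 0 ^ 3 + MvPolynomial.X 1 ^ 6 + MvPolynomial.X 3 ^ 3 * MvPolynomial.X 0 ^ 2)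
    (hprime : (Ideal.span {f}).IsPrime) (v : Fin 4) :
    Ideal.Quotient.mk (Ideal.span {f}) (MvPolynomial.X v) ≠ 0 := by
  intro h
  refine PrimeTransfer.X_not_mem_span_of_isPrime hprime ?_ (Ideal.Quotient.eq_zero_iff_mem.mp h)
  -- a point `a` with `a v = 0` and `f(a) = 1`
  by_cases hv : v = 0
  · subst hv
    refine ThreefoldNotDvd.not_mem_span_X_of_eval_eq_one 0 ![0, 1, 0, 0] rfl ?_
    subst hf; simp
  · refine ThreefoldNotDvd.not_mem_span_X_of_eval_eq_one v ![1, 0, 0, 0] ?_ ?_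
    · fin_cases v <;> simp_all
    · subst hf; simp

/-- **THE CALIBRATION `f₄`** (registered stub `stub_f4WeightedFiModel`, §15 #24 of line `Sketch`, crux
stmt-ResolutionOfSingularities-15315; see the module docstring): the weighted blow-up of the origin of `X₂²+X₀³+X₁⁶+X₃³X₀² = 0`
(char `5`, weights `(6,3,9,2)`, `N = 18`) is an F-injective Macaulayfication. [folklore] -/
theorem stub_f4WeightedFiModel : ∀ (k : Type) [Field k] [CharP k 5] (f : MvPolynomial (Fin 4) k), f = MvPolynomial.X 2 ^ 2 + MvPolynomial.X 0 ^ 3 + MvPolynomial.X 1 ^ 6 + MvPolynomial.X 3 ^ 3 * MvPolynomial.X 0 ^ 2 → ∃ (X' : Scheme.{0}) (π : X' ⟶ Spec (.of (MvPolynomial (Fin 4) k ⧸ Ideal.span {f}))), IsProper π ∧ Literature.AlgebraicGeometry.Resolution.IsBirational π ∧ ∀ y : X', IsDomain (X'.presheaf.stalk y) ∧ ∀ d : ℕ, ringKrullDim (X'.presheaf.stalk y) = d → ∀ s : Fin d → X'.presheaf.stalk y, (Ideal.span (Set.range s)).radical.IsMaximal → RingTheory.Sequence.IsWeaklyRegular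 (X'.presheaf.stalk y) (List.ofFn s) ∧ ∀ z : X'.presheaf.stalk y, (∃ e : ℕ, z ^ 5 ^ e ∈ Ideal.span ((fun w : X'.presheaf.stalk y => w ^ 5 ^ e) '' (Ideal.span (Set.range s) : Set (X'.presheaf.stalk y)))) → z ∈ Ideal.span (Set.range s) := by
  intro k _ _ f hf
  haveI : Fact (Nat.Prime 5) := ⟨Nat.prime_five⟩
  obtain ⟨hprime, hoff⟩ := F4Isolated.stub_f4Isolated k f hf
  -- the four strict transforms
  obtain ⟨cX⟩ : Nonempty _ := ⟨F4ChartX.stub_f4ChartX k f _ hf rfl⟩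
  obtain ⟨cY⟩ : Nonempty _ := ⟨F4ChartY.stub_f4ChartY k f _ hf rfl⟩
  obtain ⟨cZ⟩ : Nonempty _ := ⟨F4ChartZ.stub_f4ChartZ k f _ hf rfl⟩
  obtain ⟨cT⟩ : Nonempty _ := ⟨F4ChartT.stub_f4ChartT k f _ hf rfl⟩
  refine WeightedConeFiModel.stub_weightedConeFiModel 5 k 4 ![6, 3, 9, 2] 18 18 ![3, 6, 2, 9] (by norm_num) (by decide)
    (VeroneseSplitting.stub_veroneseSplitting k) f
    ![MvPolynomial.X 2 ^ 2 + 1 + MvPolynomial.X 1 ^ 6 + MvPolynomial.X 3 ^ 3,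
      MvPolynomial.X 2 ^ 2 + MvPolynomial.X 0 ^ 3 + 1 + MvPolynomial.X 3 ^ 3 * MvPolynomial.X 0 ^ 2,
      1 + MvPolynomial.X 0 ^ 3 + MvPolynomial.X 1 ^ 6 + MvPolynomial.X 3 ^ 3 * MvPolynomial.X 0 ^ 2,
      MvPolynomial.X 2 ^ 2 + MvPolynomial.X 0 ^ 3 + MvPolynomial.X 1 ^ 6 + MvPolynomial.X 0 ^ 2]
    hprime (f4_X_ne_zero k f hf hprime) ?_ ?_ ?_ hoff ?_
  · -- the chart identities
    intro v
    fin_cases v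
    · exact cX.1
    · exact cY.1
    · exact cZ.1
    · exact cT.1
  · -- weighted homogeneity of the strict transforms
    intro v
    fin_cases v
    · have e1 : (fun j : Fin 4 => if j = (0 : Fin 4) then (1 : ZMod ((![6, 3, 9, 2] : Fin 4 → ℕ) 0))
          else -(((![6, 3, 9, 2] : Fin 4 → ℕ) j : ℕ) : ZMod ((![6, 3, 9, 2] : Fin 4 → ℕ) 0))) =
          (![1, -3, -9, -2] : Fin 4 → ZMod 6) := by
        funext j; fin_cases j <;> decide
      have e2 : (-((18 : ℕ) : ZMod ((![6, 3, 9, 2] : Fin 4 → ℕ) 0))) = (0 : ZMod 6) := by decide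
      have h := cX.2.1
      rw [← e1, ← e2] at h
      exact h
    · have e1 : (fun j : Fin 4 => if j = (1 : Fin 4) then (1 : ZMod ((![6, 3, 9, 2] : Fin 4 → ℕ) 1))
          else -(((![6, 3, 9, 2] : Fin 4 → ℕ) j : ℕ) : ZMod ((![6, 3, 9, 2] : Fin 4 → ℕ) 1))) =
          (![-6, 1, -9, -2] : Fin 4 → ZMod 3) := by
        funext j; fin_cases j <;> decide
      have e2 : (-((18 : ℕ) : ZMod ((![6, 3, 9, 2] : Fin 4 → ℕ) 1))) = (0 : ZMod 3) := by decide
      have h := cY.2.1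
      rw [← e1, ← e2] at h
      exact h
    · have e1 : (fun j : Fin 4 => if j = (2 : Fin 4) then (1 : ZMod ((![6, 3, 9, 2] : Fin 4 → ℕ) 2))
          else -(((![6, 3, 9, 2] : Fin 4 → ℕ) j : ℕ) : ZMod ((![6, 3, 9, 2] : Fin 4 → ℕ) 2))) =
          (![-6, -3, 1, -2] : Fin 4 → ZMod 9) := by
        funext j; fin_cases j <;> decide
      have e2 : (-((18 : ℕ) : ZMod ((![6, 3, 9, 2] : Fin 4 → ℕ) 2))) = (0 : ZMod 9) := by decide
      have h := cZ.2.1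
      rw [← e1, ← e2] at h
      exact h
    · have e1 : (fun j : Fin 4 => if j = (3 : Fin 4) then (1 : ZMod ((![6, 3, 9, 2] : Fin 4 → ℕ) 3))
          else -(((![6, 3, 9, 2] : Fin 4 → ℕ) j : ℕ) : ZMod ((![6, 3, 9, 2] : Fin 4 → ℕ) 3))) =
          (![-6, -3, -9, 1] : Fin 4 → ZMod 2) := by
        funext j; fin_cases j <;> decide
      have e2 : (-((18 : ℕ) : ZMod ((![6, 3, 9, 2] : Fin 4 → ℕ) 3))) = (0 : ZMod 2) := by decide
      have h := cT.2.1
      rw [← e1, ← e2] at h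
      exact h
  · -- no chart variable divides its strict transform
    intro v
    fin_cases v
    · exact cX.2.2.1
    · exact cY.2.2.1
    · exact cZ.2.2.1
    · exact cT.2.2.1
  · -- the chart clauses (at every maximal ideal of `k[X]/(g_v)`)
    intro v
    fin_cases v
    · intro Q hQ _
      have hc' := cX.2.2.2
      exact @hc' Q hQ
    · intro Q hQ _
      have hc' := cY.2.2.2
      exact @hc' Q hQ
    · intro Q hQ _
      have hc' := cZ.2.2.2
      exact @hc' Q hQ
    · intro Q hQ _
      have hc' := cT.2.2.2
      exact @hc' Q hQ


end Summit.ResolutionOfSingularities.ResolutionOfSingularities.Theorems.FInjectiveMacaulayfication.F4WeightedFiModel
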